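import Summits.Ventures.PercRepro2.CaseOneA2EdgeQId
import Summits.Ventures.PercRepro2.CaseOneA2EdgeQB
import Summits.Ventures.PercRepro2.CaseOneA2EdgeDelete

/-!
# The `(ii-Q)` form along an `a₂a₃`-edge: the threshold-domination transfer (blind cell PercRepro2,
p1 g30; the identities are in `CaseOneA2EdgeQId.lean`, the `b`-side coefficients in `CaseOneA2EdgeQB.lean`)

With `Λ(c, y) = c₁ (y₁ P₄ − y₀ P₃) − c₀ (y₁ P₂ − y₀ P₁)` the `(ii)` form of `G − e₂` at the `o`-pair
`c` and the `b`-pair `y` (`iiExprQ_a2_edge`): the coefficient `Λ(c⁰, y¹)` is `≥ 0` by the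
`b`-threshold monotonicity (`a2_bThreshold_nonneg`) and the Q-odds lemma `odds_q`
(**`lamQ_c0_y1_nonneg`**); the coefficients with the forced-open `o`-pair
`c¹ = (P₁(Q, o ∈ U), P₁(Q))` are `≥ 0` as soon as `c¹` DOMINATES one of the two `o`-pairs of `G − e₂`:
`D₀ₒ · P₁(Q) ≤ P₁(Q, o ∈ U) · D₀` (the PD pair; **`lamQ_c1_nonneg`**, via
`D₀ · Λ(c¹, y) = P₁(Q) · Λ(PD₀, y) − (D₀ P₁(Q, o ∈ U) − D₀ₒ P₁(Q)) · (y₁ P₂ − y₀ P₁)`, the case `D₀ = 0`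
by the four functions bound `pT1_mul_pT_le_Dpd`) or `Dqo₀ · P₁(Q) ≤ P₁(Q, o ∈ U) · P₀(Q)` (the Q pair;
**`lamQ_c1_nonneg_ofQ`**). Hence **`zSplitIIQ_of_a2_edge`**: under either domination,
`(ii)(G − e₂) ∧ (ii-Q)(G − e₂) ⟹ (ii-Q)(G)`. THE DOMINATION IS A HYPOTHESIS, NOT A LEMMA: it fails on
rare instances (relative size `10⁻⁶` in the thresholds; the witness in proofs/P1-G30.md §2′, where
the four forms of `G` nevertheless stay `≥ 0`), so the `a₂`-edge rule for the Q-threshold forms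
stays open; this file is the transfer on the generic instances. The mirror `(i-Q)` and the four
forms are in `CaseOneA2EdgeIQ.lean`. Own code; standard axioms.
-/

namespace Summit.Ventures.PercRepro2

namespace CaseOne

section Signs
variable {V : Type*} {E : Type*} [Fintype E] [DecidableEq E] [Fintype V] [DecidableEq V]
  {R : Type*} [Field R] [LinearOrder R] [IsStrictOrderedRing R]
variable {ends : E → Sym2 V} {a₁ a₂ a₃ : V} {e₂ : E}

omit [Fintype V] [DecidableEq V] in
/-- **The forced-open `o`-pair dominates the PD pair of `G − e₂` in every `(ii)`-type form, given
ODDS-3E**: with `c¹ = (P₁(Q, o ∈ U), P₁(Q))`, for every `b`-pair `(y₀, y₁)` with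
`B(y) = y₁ P₂ − y₀ P₁ ≤ 0` and `Λ(PD₀, y) ≥ 0`, also `Λ(c¹, y) ≥ 0`. -/
theorem lamQ_c1_nonneg (p : E → R) (hp : IsProbVec p) (he : ends e₂ = s(a₂, a₃)) (o b : V)
    (hodds : Dpdo (Function.update p e₂ 0) ends o a₁ a₂ a₃ *
        prob (Function.update p e₂ 1) (connEvent ends a₁ a₂)ᶜ ≤
      Dqo (Function.update p e₂ 1) ends o a₁ a₂ * Dpd (Function.update p e₂ 0) ends a₁ a₂ a₃)
    (y₀ y₁ : R)
    (hB : y₁ * prob (Function.update p e₂ 0) (connEvent ends a₂ b ∩ connEvent ends a₁ a₃ ∩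
        (connEvent ends a₁ a₂)ᶜ) -
      y₀ * prob (Function.update p e₂ 0) (connEvent ends a₁ a₃ ∩ (connEvent ends a₁ a₂)ᶜ) ≤ 0)
    (hΛ : 0 ≤ Dpd (Function.update p e₂ 0) ends a₁ a₂ a₃ *
        (y₁ * prob (Function.update p e₂ 0) (connEvent ends a₂ b ∩ connEvent ends a₁ a₃ ∩
            connEvent ends a₂ o ∩ (connEvent ends a₁ a₂)ᶜ) -
          y₀ * prob (Function.update p e₂ 0) (connEvent ends a₁ a₃ ∩ connEvent ends a₂ o ∩
            (connEvent ends a₁ a₂)ᶜ)) -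
        Dpdo (Function.update p e₂ 0) ends o a₁ a₂ a₃ *
        (y₁ * prob (Function.update p e₂ 0) (connEvent ends a₂ b ∩ connEvent ends a₁ a₃ ∩
            (connEvent ends a₁ a₂)ᶜ) -
          y₀ * prob (Function.update p e₂ 0) (connEvent ends a₁ a₃ ∩ (connEvent ends a₁ a₂)ᶜ))) :
    0 ≤ prob (Function.update p e₂ 1) (connEvent ends a₁ a₂)ᶜ *
        (y₁ * prob (Function.update p e₂ 0) (connEvent ends a₂ b ∩ connEvent ends a₁ a₃ ∩
            connEvent ends a₂ o ∩ (connEvent ends a₁ a₂)ᶜ) -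
          y₀ * prob (Function.update p e₂ 0) (connEvent ends a₁ a₃ ∩ connEvent ends a₂ o ∩
            (connEvent ends a₁ a₂)ᶜ)) -
        Dqo (Function.update p e₂ 1) ends o a₁ a₂ *
        (y₁ * prob (Function.update p e₂ 0) (connEvent ends a₂ b ∩ connEvent ends a₁ a₃ ∩
            (connEvent ends a₁ a₂)ᶜ) -
          y₀ * prob (Function.update p e₂ 0) (connEvent ends a₁ a₃ ∩ (connEvent ends a₁ a₂)ᶜ)) := by
  set p₀ := Function.update p e₂ 0 with hp₀
  set p₁ := Function.update p e₂ 1 with hp₁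
  have hp0 : IsProbVec p₀ := hp.update e₂ le_rfl zero_le_one
  have hp1 : IsProbVec p₁ := hp.update e₂ zero_le_one le_rfl
  set Av := y₁ * prob p₀ (connEvent ends a₂ b ∩ connEvent ends a₁ a₃ ∩ connEvent ends a₂ o ∩
      (connEvent ends a₁ a₂)ᶜ) -
    y₀ * prob p₀ (connEvent ends a₁ a₃ ∩ connEvent ends a₂ o ∩ (connEvent ends a₁ a₂)ᶜ) with hAv
  set Bv := y₁ * prob p₀ (connEvent ends a₂ b ∩ connEvent ends a₁ a₃ ∩ (connEvent ends a₁ a₂)ᶜ) -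
    y₀ * prob p₀ (connEvent ends a₁ a₃ ∩ (connEvent ends a₁ a₂)ᶜ) with hBv
  have hD : 0 ≤ Dpd p₀ ends a₁ a₂ a₃ := prob_nonneg hp0 _
  have hX1 : 0 ≤ prob p₁ (connEvent ends a₁ a₂)ᶜ := prob_nonneg hp1 _
  have hcoef : 0 ≤ Dqo p₁ ends o a₁ a₂ * Dpd p₀ ends a₁ a₂ a₃ -
      Dpdo p₀ ends o a₁ a₂ a₃ * prob p₁ (connEvent ends a₁ a₂)ᶜ := sub_nonneg.mpr hodds
  -- the identity `D₀ · Λ(c¹, y) = X₁ · Λ(PD₀, y) − (D₀ U₁ − D₀ₒ X₁) · B(y)`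
  have key : Dpd p₀ ends a₁ a₂ a₃ * (prob p₁ (connEvent ends a₁ a₂)ᶜ * Av - Dqo p₁ ends o a₁ a₂ * Bv) =
      prob p₁ (connEvent ends a₁ a₂)ᶜ * (Dpd p₀ ends a₁ a₂ a₃ * Av - Dpdo p₀ ends o a₁ a₂ a₃ * Bv) -
        (Dqo p₁ ends o a₁ a₂ * Dpd p₀ ends a₁ a₂ a₃ -
          Dpdo p₀ ends o a₁ a₂ a₃ * prob p₁ (connEvent ends a₁ a₂)ᶜ) * Bv := by
    ring
  have hrhs : 0 ≤ prob p₁ (connEvent ends a₁ a₂)ᶜ *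
      (Dpd p₀ ends a₁ a₂ a₃ * Av - Dpdo p₀ ends o a₁ a₂ a₃ * Bv) -
        (Dqo p₁ ends o a₁ a₂ * Dpd p₀ ends a₁ a₂ a₃ -
          Dpdo p₀ ends o a₁ a₂ a₃ * prob p₁ (connEvent ends a₁ a₂)ᶜ) * Bv := by
    have h1 := mul_nonneg hX1 hΛ
    have h2 := mul_nonneg hcoef (neg_nonneg.mpr hB)
    linarith
  rw [← key] at hrhs
  rcases eq_or_lt_of_le hD with hD0 | hDpos
  · -- `D₀ = 0`: by the four functions theorem one of the two `a₃`-worlds of `G − e₂` is null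
    have hff := pT1_mul_pT_le_Dpd (ends := ends) (a₁ := a₁) (a₂ := a₂) (a₃ := a₃) p₀ hp0
    rw [← hD0] at hff
    have hT1 : 0 ≤ prob p₀ (connEvent ends a₁ a₃ ∩ (connEvent ends a₁ a₂)ᶜ) := prob_nonneg hp0 _
    have hT2 : 0 ≤ prob p₀ (connEvent ends a₂ a₃ ∩ (connEvent ends a₁ a₂)ᶜ) := prob_nonneg hp0 _
    rcases eq_or_lt_of_le hT1 with h1 | h1
    · -- every `a₃`-mass vanishes
      have hz : ∀ Y : Set (Config E), Y ⊆ connEvent ends a₁ a₃ ∩ (connEvent ends a₁ a₂)ᶜ →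
          prob p₀ Y = 0 := fun Y hY =>
        le_antisymm (by rw [h1]; exact prob_mono hp0 hY) (prob_nonneg hp0 Y)
      have z4 : prob p₀ (connEvent ends a₂ b ∩ connEvent ends a₁ a₃ ∩ connEvent ends a₂ o ∩
          (connEvent ends a₁ a₂)ᶜ) = 0 := hz _ (fun _ h => ⟨h.1.1.2, h.2⟩)
      have z3 : prob p₀ (connEvent ends a₁ a₃ ∩ connEvent ends a₂ o ∩ (connEvent ends a₁ a₂)ᶜ) = 0 :=
        hz _ (fun _ h => ⟨h.1.1, h.2⟩)
      have z2 : prob p₀ (connEvent ends a₂ b ∩ connEvent ends a₁ a₃ ∩ (connEvent ends a₁ a₂)ᶜ) = 0 :=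
        hz _ (fun _ h => ⟨h.1.2, h.2⟩)
      have z1 : prob p₀ (connEvent ends a₁ a₃ ∩ (connEvent ends a₁ a₂)ᶜ) = 0 := hz _ (fun _ h => h)
      rw [hAv, hBv, z4, z3, z2, z1]
      simp
    · -- `P₀(Q, a₃ ∈ C₂) = 0`, so the forced-open pair vanishes
      have h2 : prob p₀ (connEvent ends a₂ a₃ ∩ (connEvent ends a₁ a₂)ᶜ) = 0 := by
        by_contra hne
        have h2pos : 0 < prob p₀ (connEvent ends a₂ a₃ ∩ (connEvent ends a₁ a₂)ᶜ) :=
          lt_of_le_of_ne hT2 (Ne.symm hne)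
        linarith [mul_pos h1 h2pos]
      have hX1z : prob p₁ (connEvent ends a₁ a₂)ᶜ = 0 := by
        rw [hp₁, prob_Q_update_one_eq_Dpd_add (a₁ := a₁) p he, ← hp₀, ← hD0, h2, add_zero]
      have hU1z : Dqo p₁ ends o a₁ a₂ = 0 := by
        refine le_antisymm ?_ (prob_nonneg hp1 _)
        rw [← hX1z]
        unfold Dqo
        exact prob_mono hp1 (fun _ h => h.2)
      rw [hX1z, hU1z]
      simp
  · exact nonneg_of_mul_nonneg_right hrhs hDpos

omit [Fintype V] [DecidableEq V] in
/-- **The forced-open `o`-pair dominates the Q pair of `G − e₂` in every `(ii)`-type form, given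
`Dqo₀ · P₁(Q) ≤ P₁(Q, o ∈ U) · P₀(Q)`**: for every `b`-pair with `B(y) ≤ 0` and `Λ(c⁰, y) ≥ 0`, also
`Λ(c¹, y) ≥ 0`. -/
theorem lamQ_c1_nonneg_ofQ (p : E → R) (hp : IsProbVec p) (o b : V)
    (hq : Dqo (Function.update p e₂ 0) ends o a₁ a₂ *
        prob (Function.update p e₂ 1) (connEvent ends a₁ a₂)ᶜ ≤
      Dqo (Function.update p e₂ 1) ends o a₁ a₂ * prob (Function.update p e₂ 0) (connEvent ends a₁ a₂)ᶜ)
    (y₀ y₁ : R)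
    (hB : y₁ * prob (Function.update p e₂ 0) (connEvent ends a₂ b ∩ connEvent ends a₁ a₃ ∩
        (connEvent ends a₁ a₂)ᶜ) -
      y₀ * prob (Function.update p e₂ 0) (connEvent ends a₁ a₃ ∩ (connEvent ends a₁ a₂)ᶜ) ≤ 0)
    (hΛ : 0 ≤ prob (Function.update p e₂ 0) (connEvent ends a₁ a₂)ᶜ *
        (y₁ * prob (Function.update p e₂ 0) (connEvent ends a₂ b ∩ connEvent ends a₁ a₃ ∩
            connEvent ends a₂ o ∩ (connEvent ends a₁ a₂)ᶜ) -
          y₀ * prob (Function.update p e₂ 0) (connEvent ends a₁ a₃ ∩ connEvent ends a₂ o ∩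
            (connEvent ends a₁ a₂)ᶜ)) -
        Dqo (Function.update p e₂ 0) ends o a₁ a₂ *
        (y₁ * prob (Function.update p e₂ 0) (connEvent ends a₂ b ∩ connEvent ends a₁ a₃ ∩
            (connEvent ends a₁ a₂)ᶜ) -
          y₀ * prob (Function.update p e₂ 0) (connEvent ends a₁ a₃ ∩ (connEvent ends a₁ a₂)ᶜ))) :
    0 ≤ prob (Function.update p e₂ 1) (connEvent ends a₁ a₂)ᶜ *
        (y₁ * prob (Function.update p e₂ 0) (connEvent ends a₂ b ∩ connEvent ends a₁ a₃ ∩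
            connEvent ends a₂ o ∩ (connEvent ends a₁ a₂)ᶜ) -
          y₀ * prob (Function.update p e₂ 0) (connEvent ends a₁ a₃ ∩ connEvent ends a₂ o ∩
            (connEvent ends a₁ a₂)ᶜ)) -
        Dqo (Function.update p e₂ 1) ends o a₁ a₂ *
        (y₁ * prob (Function.update p e₂ 0) (connEvent ends a₂ b ∩ connEvent ends a₁ a₃ ∩
            (connEvent ends a₁ a₂)ᶜ) -
          y₀ * prob (Function.update p e₂ 0) (connEvent ends a₁ a₃ ∩ (connEvent ends a₁ a₂)ᶜ)) := by
  set p₀ := Function.update p e₂ 0 with hp₀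
  set p₁ := Function.update p e₂ 1 with hp₁
  have hp0 : IsProbVec p₀ := hp.update e₂ le_rfl zero_le_one
  have hp1 : IsProbVec p₁ := hp.update e₂ zero_le_one le_rfl
  set Av := y₁ * prob p₀ (connEvent ends a₂ b ∩ connEvent ends a₁ a₃ ∩ connEvent ends a₂ o ∩
      (connEvent ends a₁ a₂)ᶜ) -
    y₀ * prob p₀ (connEvent ends a₁ a₃ ∩ connEvent ends a₂ o ∩ (connEvent ends a₁ a₂)ᶜ) with hAv
  set Bv := y₁ * prob p₀ (connEvent ends a₂ b ∩ connEvent ends a₁ a₃ ∩ (connEvent ends a₁ a₂)ᶜ) -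
    y₀ * prob p₀ (connEvent ends a₁ a₃ ∩ (connEvent ends a₁ a₂)ᶜ) with hBv
  have hX0 : 0 ≤ prob p₀ (connEvent ends a₁ a₂)ᶜ := prob_nonneg hp0 _
  have hX1 : 0 ≤ prob p₁ (connEvent ends a₁ a₂)ᶜ := prob_nonneg hp1 _
  have hcoef : 0 ≤ Dqo p₁ ends o a₁ a₂ * prob p₀ (connEvent ends a₁ a₂)ᶜ -
      Dqo p₀ ends o a₁ a₂ * prob p₁ (connEvent ends a₁ a₂)ᶜ := sub_nonneg.mpr hq
  have key : prob p₀ (connEvent ends a₁ a₂)ᶜ *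
      (prob p₁ (connEvent ends a₁ a₂)ᶜ * Av - Dqo p₁ ends o a₁ a₂ * Bv) =
      prob p₁ (connEvent ends a₁ a₂)ᶜ *
        (prob p₀ (connEvent ends a₁ a₂)ᶜ * Av - Dqo p₀ ends o a₁ a₂ * Bv) -
        (Dqo p₁ ends o a₁ a₂ * prob p₀ (connEvent ends a₁ a₂)ᶜ -
          Dqo p₀ ends o a₁ a₂ * prob p₁ (connEvent ends a₁ a₂)ᶜ) * Bv := by
    ring
  have hrhs : 0 ≤ prob p₁ (connEvent ends a₁ a₂)ᶜ *
        (prob p₀ (connEvent ends a₁ a₂)ᶜ * Av - Dqo p₀ ends o a₁ a₂ * Bv) -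
        (Dqo p₁ ends o a₁ a₂ * prob p₀ (connEvent ends a₁ a₂)ᶜ -
          Dqo p₀ ends o a₁ a₂ * prob p₁ (connEvent ends a₁ a₂)ᶜ) * Bv := by
    have h1 := mul_nonneg hX1 hΛ
    have h2 := mul_nonneg hcoef (neg_nonneg.mpr hB)
    linarith
  rw [← key] at hrhs
  rcases eq_or_lt_of_le hX0 with hX0' | hX0'
  · have hz : ∀ Y : Set (Config E), Y ⊆ (connEvent ends a₁ a₂)ᶜ → prob p₀ Y = 0 := fun Y hY =>
      le_antisymm (by rw [hX0']; exact prob_mono hp0 hY) (prob_nonneg hp0 Y)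
    have z4 : prob p₀ (connEvent ends a₂ b ∩ connEvent ends a₁ a₃ ∩ connEvent ends a₂ o ∩
        (connEvent ends a₁ a₂)ᶜ) = 0 := hz _ (fun _ h => h.2)
    have z3 : prob p₀ (connEvent ends a₁ a₃ ∩ connEvent ends a₂ o ∩ (connEvent ends a₁ a₂)ᶜ) = 0 :=
      hz _ (fun _ h => h.2)
    have z2 : prob p₀ (connEvent ends a₂ b ∩ connEvent ends a₁ a₃ ∩ (connEvent ends a₁ a₂)ᶜ) = 0 :=
      hz _ (fun _ h => h.2)
    have z1 : prob p₀ (connEvent ends a₁ a₃ ∩ (connEvent ends a₁ a₂)ᶜ) = 0 := hz _ (fun _ h => h.2)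
    rw [hAv, hBv, z4, z3, z2, z1]
    simp
  · exact nonneg_of_mul_nonneg_right hrhs hX0'

end Signs

/-! ## The theorems -/

section Theorems
variable {V : Type*} {E : Type*} [Fintype E] [DecidableEq E] [Fintype V] [DecidableEq V]
  {R : Type*} [Field R] [LinearOrder R] [IsStrictOrderedRing R]
variable {ends : E → Sym2 V} {a₁ a₂ a₃ : V} {e₂ : E}

/-- **`(ii-Q)` lifts along an `a₂a₃`-edge under the threshold domination**: if the forced-open
`o`-pair dominates the PD pair OR the Q pair of `G − e₂`, then `(ii)(G − e₂) ∧ (ii-Q)(G − e₂) ⟹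
`(ii-Q)(G)`. (The domination is a hypothesis that fails on rare instances — proofs/P1-G30.md §2′.) -/
theorem zSplitIIQ_of_a2_edge (p : E → R) (hp : IsProbVec p) (he : ends e₂ = s(a₂, a₃)) (o b : V)
    (hdom : Dpdo (Function.update p e₂ 0) ends o a₁ a₂ a₃ *
        prob (Function.update p e₂ 1) (connEvent ends a₁ a₂)ᶜ ≤
      Dqo (Function.update p e₂ 1) ends o a₁ a₂ * Dpd (Function.update p e₂ 0) ends a₁ a₂ a₃ ∨
      Dqo (Function.update p e₂ 0) ends o a₁ a₂ *
        prob (Function.update p e₂ 1) (connEvent ends a₁ a₂)ᶜ ≤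
      Dqo (Function.update p e₂ 1) ends o a₁ a₂ * prob (Function.update p e₂ 0) (connEvent ends a₁ a₂)ᶜ)
    (hII : ZSplitII (Function.update p e₂ 0) ends o a₁ a₂ a₃ b)
    (hQ : ZSplitIIQ (Function.update p e₂ 0) ends o a₁ a₂ a₃ b) :
    ZSplitIIQ p ends o a₁ a₂ a₃ b := by
  unfold ZSplitIIQ
  rw [iiExprQ_a2_edge p he o b]
  have hr0 : 0 ≤ p e₂ := hp.nonneg e₂
  have hr1 : 0 ≤ 1 - p e₂ := by linarith [hp.le_one e₂]
  have hp0 : IsProbVec (Function.update p e₂ 0) := hp.update e₂ le_rfl zero_le_one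
  -- the four coefficients
  have c00 : 0 ≤ iiExprT (Function.update p e₂ 0) ends o a₁ a₂ a₃ b
      (Dqo (Function.update p e₂ 0) ends o a₁ a₂) (prob (Function.update p e₂ 0) (connEvent ends a₁ a₂)ᶜ) := hQ
  have c01 := lamQ_c0_y1_nonneg p hp he o b hQ
  have hIIe : 0 ≤ Dpd (Function.update p e₂ 0) ends a₁ a₂ a₃ *
      (prob (Function.update p e₂ 0) (connEvent ends a₁ a₂)ᶜ *
        prob (Function.update p e₂ 0) (connEvent ends a₂ b ∩ connEvent ends a₁ a₃ ∩
          connEvent ends a₂ o ∩ (connEvent ends a₁ a₂)ᶜ) -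
      prob (Function.update p e₂ 0) (connEvent ends a₂ b ∩ (connEvent ends a₁ a₂)ᶜ) *
        prob (Function.update p e₂ 0) (connEvent ends a₁ a₃ ∩ connEvent ends a₂ o ∩
          (connEvent ends a₁ a₂)ᶜ)) -
      Dpdo (Function.update p e₂ 0) ends o a₁ a₂ a₃ *
      (prob (Function.update p e₂ 0) (connEvent ends a₁ a₂)ᶜ *
        prob (Function.update p e₂ 0) (connEvent ends a₂ b ∩ connEvent ends a₁ a₃ ∩
          (connEvent ends a₁ a₂)ᶜ) -
      prob (Function.update p e₂ 0) (connEvent ends a₂ b ∩ (connEvent ends a₁ a₂)ᶜ) *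
        prob (Function.update p e₂ 0) (connEvent ends a₁ a₃ ∩ (connEvent ends a₁ a₂)ᶜ)) := by
    have := hII
    unfold ZSplitII at this
    rw [iiExpr_eq_iiExprT, iiExprT_eq] at this
    exact this
  have hQe : 0 ≤ prob (Function.update p e₂ 0) (connEvent ends a₁ a₂)ᶜ *
      (prob (Function.update p e₂ 0) (connEvent ends a₁ a₂)ᶜ *
        prob (Function.update p e₂ 0) (connEvent ends a₂ b ∩ connEvent ends a₁ a₃ ∩
          connEvent ends a₂ o ∩ (connEvent ends a₁ a₂)ᶜ) -
      prob (Function.update p e₂ 0) (connEvent ends a₂ b ∩ (connEvent ends a₁ a₂)ᶜ) *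
        prob (Function.update p e₂ 0) (connEvent ends a₁ a₃ ∩ connEvent ends a₂ o ∩
          (connEvent ends a₁ a₂)ᶜ)) -
      Dqo (Function.update p e₂ 0) ends o a₁ a₂ *
      (prob (Function.update p e₂ 0) (connEvent ends a₁ a₂)ᶜ *
        prob (Function.update p e₂ 0) (connEvent ends a₂ b ∩ connEvent ends a₁ a₃ ∩
          (connEvent ends a₁ a₂)ᶜ) -
      prob (Function.update p e₂ 0) (connEvent ends a₂ b ∩ (connEvent ends a₁ a₂)ᶜ) *
        prob (Function.update p e₂ 0) (connEvent ends a₁ a₃ ∩ (connEvent ends a₁ a₂)ᶜ)) := by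
    have := hQ
    unfold ZSplitIIQ at this
    rw [iiExprT_eq] at this
    exact this
  have c10 : 0 ≤ prob (Function.update p e₂ 1) (connEvent ends a₁ a₂)ᶜ *
      (prob (Function.update p e₂ 0) (connEvent ends a₁ a₂)ᶜ *
        prob (Function.update p e₂ 0) (connEvent ends a₂ b ∩ connEvent ends a₁ a₃ ∩
          connEvent ends a₂ o ∩ (connEvent ends a₁ a₂)ᶜ) -
      prob (Function.update p e₂ 0) (connEvent ends a₂ b ∩ (connEvent ends a₁ a₂)ᶜ) *
        prob (Function.update p e₂ 0) (connEvent ends a₁ a₃ ∩ connEvent ends a₂ o ∩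
          (connEvent ends a₁ a₂)ᶜ)) -
      Dqo (Function.update p e₂ 1) ends o a₁ a₂ *
      (prob (Function.update p e₂ 0) (connEvent ends a₁ a₂)ᶜ *
        prob (Function.update p e₂ 0) (connEvent ends a₂ b ∩ connEvent ends a₁ a₃ ∩
          (connEvent ends a₁ a₂)ᶜ) -
      prob (Function.update p e₂ 0) (connEvent ends a₂ b ∩ (connEvent ends a₁ a₂)ᶜ) *
        prob (Function.update p e₂ 0) (connEvent ends a₁ a₃ ∩ (connEvent ends a₁ a₂)ᶜ)) := by
    rcases hdom with hodds | hq
    · exact lamQ_c1_nonneg p hp he o b hodds _ _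
        (bhk14_cleared (ends := ends) (a₁ := a₁) (a₂ := a₂) (a₃ := a₃) _ hp0 b) hIIe
    · exact lamQ_c1_nonneg_ofQ p hp o b hq _ _
        (bhk14_cleared (ends := ends) (a₁ := a₁) (a₂ := a₂) (a₃ := a₃) _ hp0 b) hQe
  have c11 : 0 ≤ prob (Function.update p e₂ 1) (connEvent ends a₁ a₂)ᶜ *
      (prob (Function.update p e₂ 1) (connEvent ends a₁ a₂)ᶜ *
        prob (Function.update p e₂ 0) (connEvent ends a₂ b ∩ connEvent ends a₁ a₃ ∩
          connEvent ends a₂ o ∩ (connEvent ends a₁ a₂)ᶜ) -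
      prob (Function.update p e₂ 1) (connEvent ends a₂ b ∩ (connEvent ends a₁ a₂)ᶜ) *
        prob (Function.update p e₂ 0) (connEvent ends a₁ a₃ ∩ connEvent ends a₂ o ∩
          (connEvent ends a₁ a₂)ᶜ)) -
      Dqo (Function.update p e₂ 1) ends o a₁ a₂ *
      (prob (Function.update p e₂ 1) (connEvent ends a₁ a₂)ᶜ *
        prob (Function.update p e₂ 0) (connEvent ends a₂ b ∩ connEvent ends a₁ a₃ ∩
          (connEvent ends a₁ a₂)ᶜ) -
      prob (Function.update p e₂ 1) (connEvent ends a₂ b ∩ (connEvent ends a₁ a₂)ᶜ) *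
        prob (Function.update p e₂ 0) (connEvent ends a₁ a₃ ∩ (connEvent ends a₁ a₂)ᶜ)) := by
    rcases hdom with hodds | hq
    · exact lamQ_c1_nonneg p hp he o b hodds _ _ (bhk14_forced_open p hp he b)
        (a2MixII_nonneg p hp he o b hII)
    · exact lamQ_c1_nonneg_ofQ p hp o b hq _ _ (bhk14_forced_open p hp he b) c01
  have hmid := add_nonneg c01 c10
  exact mul_nonneg hr1 (add_nonneg (add_nonneg (mul_nonneg (pow_nonneg hr1 2) c00)
    (mul_nonneg (mul_nonneg hr0 hr1) hmid)) (mul_nonneg (pow_nonneg hr0 2) c11))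

end Theorems

end CaseOne

end Summit.Ventures.PercRepro2
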